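import Summits.QuantumFields.YangMills.Theorems.FluctuationComparisonRegPrIntLS2BetaNeighbourhoodKernelTorus
import Summits.QuantumFields.YangMills.Theorems.FluctuationComparisonRegPrIntLS2BetaCorrMeanFlux
import Summits.QuantumFields.YangMills.Theorems.FluctuationComparisonRegPrIntLS2BetaOneStepMeanLetter
import HarnessLib

/-!
# F4 — THE CORRECTION-FACTOR LETTER IN ℓ²: `‖dist1 corr‖_{ℓ²(coarse bonds)} ≤ C(L,d)·‖dist1 U(∂·)‖_{ℓ²(fine plaquettes)}`, one level, through the neighbourhood kernel
# (crux `FluctuationComparisonRegPrIntL`, stmt-QuantumFields-20520; registry v11.4 `Cruxes/FluctuationComparisonRegPrIntL/Lines/semiclassical_s2beta.lean` 3732b7df FROZEN, untouched)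

Cell `ym3-torus` (YM ladder rung R3 = continuum `SU(2)` Yang–Mills on the three-torus — a RUNG: NOT d = 4, NOT infinite volume, NOT a mass gap, NOT Clay).
Width seat `ym3-torus-px21` (gen 21); feeder (F4) of the one-level letter (H) of ✓p816498 `…S2BetaHFlatOfRelativeLetter` (px17 g19; UV3-NODE §65.3), named to this
seat by px8 g21 (UV3-NODE §64.6 (3), bus 08:21∕08:27Z «G12 or (b3), your pick») with px10 g22's route (bus 08:27:21Z: «NO ribbon kernel needed»).
`--kind proof --supports stmt-QuantumFields-20520 --as helper`, count-neutral, DEFINITION-FREE (0 `def`, 0 `instance`, 0 `notation`, 0 `sorry`, default heartbeats).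

ROUTE.  ✓p816875 G12 `dist1_corr_le_mean` (px8 g21): `dist1 κ_c ≤ 3·|Idx|⁻¹·Σ_i dist1 W_{c,i}` under a global small-loop guard; every (0.4) loop word `W_{c,i}` is a closed
word based at `emb c₋` inside the three blocks `c₋ − e, c₋, c₊` (lit ✓`BlockAveragingPlaquetteBoundLocal.dist1_loopHol_le_local`), all NEAR `c₋` in the `ℓ^∞`-distance-1 sense
of ✓p(px10 g22) `…S2BetaNeighbourhoodKernelTorus`, so `dist1 W_{c,i} ≤ (((d+2)L)²∕4)·Σ_{q ∈ N(c₋)} dist1 U(∂q)` — the local ℓ¹ flux, NO smallness needed (§2); hence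
`dist1 κ_c ≤ (3((d+2)L)²∕4)·Σ_{q ∈ N(c₋)} dist1 U(∂q)` (§3); and the BOND edition of px10's neighbourhood Schur count (rows `≤ 3^d L^d d²`, columns `≤ 3^d·d`, §1) turns it into ℓ²
(§4): ★★ `sqrt_sum_dist1_corr_sq_le`.  Constants polynomial in `L` — they land in (H)'s `C`, not in its `√L` (px10's remark).

WHAT.  §1 `card_filter_bond_src_mem_le`, `card_cobond_nbhd_le` (a fine plaquette lies in `N(c₋)` for at most `3^d·d` coarse BONDS `c`), `bond_nbhd_schur`,
`sqrt_sum_sq_le_of_le_bond_nbhd_sum` (the bond twins of px10's `card_conbhd_le` ∕ `nbhd_schur` ∕ `sqrt_sum_sq_le_of_le_nbhd_sum`); §2 `near_self`, `near_shift`, `near_unshift`,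
`le_of_forall_le_add_mul`, ★`dist1_loopHol_le_nbhd_sum` (ANY gauge group, NO smallness: each member loop `≤ K_d,L ·` the neighbourhood flux SUM); §3 ★`dist1_corr_le_nbhd_sum`
(`SU(N)`, under `PlaqSmall δ U` with `K·δ ≤ ¼`, `K·δ < δ_N` — G12's guard, supplied by `histGood`); §4 ★★`sqrt_sum_dist1_corr_sq_le` — THE LETTER; §5 ★★★`sqrt_sum_dist1_spine_sq_le`
— the SPINE edition `√(Σ_c dist1 (T_c(W)·T_c(U₀)⁻¹)²) ≤ C_c·‖dist1 W(∂·)‖₂` under `T(U₀) = ū(W)` (the `hF4` binder of ✓p817191 `…HFlatOfFeeders.relLetter_of_feeders` VERBATIM in shape,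
with `W := U′_t`, `U₀ := lift_t U′_{t+1}`, `havg` from (T5) + ✓`axialAvg_lift`; rewrite = ✓(b3) `axialAvg_mul_avgFun_inv`).

HONEST: finite combinatorics on the `Setup` torus + two cited one-level estimates (G12, the lit local Stokes bound); crude constants; nothing of Bałaban's analysis is
asserted; (H), the KEY LEMMA, `hFlat`, TUBE-REG∘, GAP♯∘, S2β, crux 20520 and `YM3TorusSU2` are NOT proved; no registered stub is closed; rung R3 = SU(2) YM₃ on T³ —
NOT d = 4, NOT infinite volume, NOT a mass gap, NOT Clay; the Yang–Mills mass gap is NOT proved.  Sorry-free, axioms standard.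

References: T. Bałaban, CMP **109** (1987) 249–301 [Balaban1987RG1] ((0.3)–(0.4) pp.252–253); CMP **98** (1985) 17–51 [Balaban1985Averaging] ((19)–(21) pp.21–22,
(26)–(27) p.22).
-/

set_option autoImplicit false

noncomputable section

namespace Summit.QuantumFields.YangMills.Theorems.FluctuationComparisonRegPrIntLS2BetaCorrLetterL2

open Finset
open Literature.MathematicalPhysics.QuantumFieldTheory.Balaban1983to89
open Literature.MathematicalPhysics.QuantumFieldTheory.Balaban1983to89.T4Continuum
open Literature.MathematicalPhysics.QuantumFieldTheory.Balaban1983to89.BlockAveraging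
open Literature.MathematicalPhysics.QuantumFieldTheory.Balaban1983to89.BlockAveragingPlaquetteBoundLocal (dist1_loopHol_le_local)
open Literature.MathematicalPhysics.QuantumFieldTheory.Balaban1983to89.ExpMeanLog (deltaSU expMeanLogSU)
open Summit.QuantumFields.YangMills.Theorems.FluctuationComparisonRegPrIntLS2BetaSchurTest (schur_test_sq)
open Summit.QuantumFields.YangMills.Theorems.FluctuationComparisonRegPrIntLS2BetaNeighbourhoodKernelTorus
  (near_symm card_near_le card_filter_blockOf_mem_le card_nbhd_le lt_nbhd_sum_add)
open Summit.QuantumFields.YangMills.Theorems.FluctuationComparisonRegPrIntLS2BetaCorrMeanFlux (dist1_corr_le_mean)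
open Summit.QuantumFields.YangMills.Theorems.FluctuationComparisonRegPrIntLS2BetaOneStepMeanLetter (axialAvg_mul_avgFun_inv)

variable {P : Params} {j k : ℕ}

/-! ## §1 The neighbourhood kernel indexed by coarse BONDS: row and column counts, Schur, the `hj` shape -/

/-- A bond is determined by its source and its direction: `#{c | c₋ ∈ X} ≤ |X|·d`. [folklore] -/
theorem card_filter_bond_src_mem_le (X : Finset (Site P k)) :
    (Finset.univ.filter (fun c : PBond P k => c.src ∈ X)).card ≤ X.card * P.d := by
  classical
  have h := Finset.card_le_card_of_injOn (s := Finset.univ.filter (fun c : PBond P k => c.src ∈ X))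
    (t := X ×ˢ (Finset.univ : Finset (Fin P.d))) (fun c => (c.src, c.dir)) (fun c hc => by
      rw [Finset.coe_filter] at hc
      simp only [Finset.coe_product, Finset.coe_univ, Set.mem_prod, Finset.mem_coe, Set.mem_univ, and_true]
      exact hc.2)
    (fun c _ c' _ heq => by
      obtain ⟨s, a⟩ := c
      obtain ⟨s', a'⟩ := c'
      simp only [Prod.mk.injEq] at heq
      obtain ⟨rfl, rfl⟩ := heq
      rfl)
  refine h.trans (le_of_eq ?_)
  rw [Finset.card_product, Finset.card_univ, Fintype.card_fin]

/-- **COLUMN COUNT, bond edition**: a fine plaquette `q` lies in the neighbourhood `N(c₋)` of at most `3^d·d` coarse bonds `c` (the coarse sites near `blockOf q₋`, times the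
directions). [cite: Balaban1987RG1, (0.3) p.252] -/
theorem card_cobond_nbhd_le (q : Plaq P j) :
    (Finset.univ.filter (fun c : PBond P (j + 1) => ∀ κ, blockOf q.src κ = c.src κ ∨ blockOf q.src κ = c.src κ + 1 ∨
      blockOf q.src κ = c.src κ - 1)).card ≤ 3 ^ P.d * P.d := by
  classical
  set S := Finset.univ.filter (fun z : Site P (j + 1) => ∀ κ, z κ = blockOf q.src κ ∨ z κ = blockOf q.src κ + 1 ∨ z κ = blockOf q.src κ - 1)
    with hS
  have hsub : Finset.univ.filter (fun c : PBond P (j + 1) => ∀ κ, blockOf q.src κ = c.src κ ∨ blockOf q.src κ = c.src κ + 1 ∨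
      blockOf q.src κ = c.src κ - 1) ⊆ Finset.univ.filter (fun c : PBond P (j + 1) => c.src ∈ S) := by
    intro c hc
    rw [Finset.mem_filter] at hc ⊢
    refine ⟨hc.1, ?_⟩
    rw [hS, Finset.mem_filter]
    exact ⟨Finset.mem_univ _, near_symm hc.2⟩
  exact (Finset.card_le_card hsub).trans ((card_filter_bond_src_mem_le S).trans (Nat.mul_le_mul_right _ (card_near_le _)))

/-- **SCHUR BOUND, bond edition**: `Σ_{c : PBond} (Σ_{q ∈ N(c₋)} g q)² ≤ (3^d·L^d·d²)·(3^d·d)·Σ_q g q²` (✓`schur_test_sq` with the indicator kernel, rows ✓`card_nbhd_le`,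
columns `card_cobond_nbhd_le`). [cite: Balaban1985Averaging, (19) p.21] -/
theorem bond_nbhd_schur (hj : j + 1 ≤ P.m + P.K) (g : Plaq P j → ℝ) :
    ∑ c : PBond P (j + 1), (∑ q ∈ Finset.univ.filter (fun q : Plaq P j => ∀ κ, blockOf q.src κ = c.src κ ∨ blockOf q.src κ = c.src κ + 1 ∨
        blockOf q.src κ = c.src κ - 1), g q) ^ 2 ≤
      ((3 ^ P.d * P.L ^ P.d * P.d ^ 2 : ℕ) : ℝ) * ((3 ^ P.d * P.d : ℕ) : ℝ) * ∑ q : Plaq P j, g q ^ 2 := by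
  classical
  have h := schur_test_sq (Finset.univ : Finset (PBond P (j + 1))) (Finset.univ : Finset (Plaq P j))
    (fun c q => if (∀ κ, blockOf q.src κ = c.src κ ∨ blockOf q.src κ = c.src κ + 1 ∨ blockOf q.src κ = c.src κ - 1) then (1 : ℝ) else 0)
    (fun c _ q _ => by positivity) (R := ((3 ^ P.d * P.L ^ P.d * P.d ^ 2 : ℕ) : ℝ)) (C := ((3 ^ P.d * P.d : ℕ) : ℝ)) (by positivity)
    (fun c _ => by
      rw [← Finset.sum_filter, Finset.sum_const, nsmul_eq_mul, mul_one]
      exact_mod_cast card_nbhd_le hj c.src)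
    (fun q _ => by
      rw [← Finset.sum_filter, Finset.sum_const, nsmul_eq_mul, mul_one]
      exact_mod_cast card_cobond_nbhd_le q) g
  simp only [ite_mul, one_mul, zero_mul, Finset.sum_ite, Finset.sum_const_zero, add_zero] at h
  convert h using 4

/-- **THE `hj`∕(F4) SHAPE, bond edition**: a non-negative coarse-BOND function dominated by `c ×` the neighbourhood sum of a fine-plaquette function has
`√(Σ_c J c²) ≤ c·√((3^d L^d d²)(3^d d))·√(Σ_q g q²)`. [cite: Balaban1985Averaging, (19) p.21] -/
theorem sqrt_sum_sq_le_of_le_bond_nbhd_sum (hj : j + 1 ≤ P.m + P.K) (g : Plaq P j → ℝ) (J : PBond P (j + 1) → ℝ) {c : ℝ} (hc : 0 ≤ c)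
    (hJ0 : ∀ b, 0 ≤ J b)
    (hJ : ∀ b, J b ≤ c * ∑ q ∈ Finset.univ.filter (fun q : Plaq P j => ∀ κ, blockOf q.src κ = b.src κ ∨ blockOf q.src κ = b.src κ + 1 ∨
        blockOf q.src κ = b.src κ - 1), g q) :
    √(∑ b : PBond P (j + 1), J b ^ 2) ≤
      c * √(((3 ^ P.d * P.L ^ P.d * P.d ^ 2 : ℕ) : ℝ) * ((3 ^ P.d * P.d : ℕ) : ℝ)) * √(∑ q : Plaq P j, g q ^ 2) := by
  have h1 : ∑ b : PBond P (j + 1), J b ^ 2 ≤ c ^ 2 * ∑ b : PBond P (j + 1), (∑ q ∈ Finset.univ.filter (fun q : Plaq P j => ∀ κ,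
      blockOf q.src κ = b.src κ ∨ blockOf q.src κ = b.src κ + 1 ∨ blockOf q.src κ = b.src κ - 1), g q) ^ 2 := by
    rw [Finset.mul_sum]
    refine Finset.sum_le_sum fun b _ => ?_
    rw [← mul_pow]
    exact pow_le_pow_left₀ (hJ0 b) (hJ b) 2
  have h2 := bond_nbhd_schur hj g
  calc √(∑ b : PBond P (j + 1), J b ^ 2)
      ≤ √(c ^ 2 * (((3 ^ P.d * P.L ^ P.d * P.d ^ 2 : ℕ) : ℝ) * ((3 ^ P.d * P.d : ℕ) : ℝ) * ∑ q : Plaq P j, g q ^ 2)) :=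
        Real.sqrt_le_sqrt (h1.trans (mul_le_mul_of_nonneg_left h2 (sq_nonneg c)))
    _ = c * √(((3 ^ P.d * P.L ^ P.d * P.d ^ 2 : ℕ) : ℝ) * ((3 ^ P.d * P.d : ℕ) : ℝ)) * √(∑ q : Plaq P j, g q ^ 2) := by
        rw [Real.sqrt_mul (sq_nonneg c), Real.sqrt_sq hc, Real.sqrt_mul (by positivity)]; ring

/-! ## §2 Every (0.4) member loop is bounded by the neighbourhood flux SUM — any gauge group, no smallness -/

/-- A coarse site is near itself. [folklore] -/
theorem near_self (y : Site P k) : ∀ κ, y κ = y κ ∨ y κ = y κ + 1 ∨ y κ = y κ - 1 := fun _ => Or.inl rfl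

/-- `y + e_μ` is near `y`. [folklore] -/
theorem near_shift (y : Site P k) (μ : Fin P.d) : ∀ κ, y.shift μ κ = y κ ∨ y.shift μ κ = y κ + 1 ∨ y.shift μ κ = y κ - 1 := by
  intro κ
  rw [Site.shift_apply]
  by_cases h : κ = μ
  · subst h; simp
  · simp [h]

/-- `y − e_μ` is near `y`. [folklore] -/
theorem near_unshift (y : Site P k) (μ : Fin P.d) : ∀ κ, y.unshift μ κ = y κ ∨ y.unshift μ κ = y κ + 1 ∨ y.unshift μ κ = y κ - 1 := by
  intro κ
  rw [Site.unshift_apply]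
  by_cases h : κ = μ
  · subst h; simp
  · simp [h]

/-- `x ≤ A + B·η` for every `η > 0` (`B ≥ 0`) forces `x ≤ A`. [folklore] -/
theorem le_of_forall_le_add_mul {x A B : ℝ} (hB : 0 ≤ B) (h : ∀ η : ℝ, 0 < η → x ≤ A + B * η) : x ≤ A := by
  refine le_of_forall_pos_le_add fun ε hε => ?_
  have hη : 0 < ε / (B + 1) := div_pos hε (by linarith)
  have h1 := h (ε / (B + 1)) hη
  have h2 : B * (ε / (B + 1)) ≤ ε := by
    rw [mul_div_assoc']
    rw [div_le_iff₀ (by linarith)]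
    nlinarith
  linarith

/-- ★ **EVERY (0.4) MEMBER LOOP IS BOUNDED BY THE NEIGHBOURHOOD FLUX SUM** (any gauge group, NO smallness hypothesis; standing range): for a coarse bond `c` and any index
`i`, `dist1 W_{c,i} ≤ (((d+2)L)²∕4)·Σ_{q ∈ N(c₋)} dist1 U(∂q)`, `N(c₋)` = the fine plaquettes based in blocks near `c₋` (lit ✓`dist1_loopHol_le_local` with the local sup
`Σ_{N(c₋)} + η`, `η ↓ 0`; the three blocks `c₋ − e, c₋, c₊` of the loop word are near `c₋`). [cite: Balaban1987RG1, (0.4) p.253; Balaban1985Averaging, (19)-(20) p.21] -/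
theorem dist1_loopHol_le_nbhd_sum {G : Type*} [GaugeGroup G] (hj : j + 1 ≤ P.m + P.K) (U : GaugeField P j G) (c : PBond P (j + 1)) (i : Idx P) :
    dist1 (loopHol U c i) ≤ ((((P.d + 2) * P.L : ℕ) : ℝ) ^ 2 / 4) *
      ∑ q ∈ Finset.univ.filter (fun q : Plaq P j => ∀ κ, blockOf q.src κ = c.src κ ∨ blockOf q.src κ = c.src κ + 1 ∨
        blockOf q.src κ = c.src κ - 1), dist1 (GaugeField.plaqHol U q) := by
  set S := ∑ q ∈ Finset.univ.filter (fun q : Plaq P j => ∀ κ, blockOf q.src κ = c.src κ ∨ blockOf q.src κ = c.src κ + 1 ∨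
        blockOf q.src κ = c.src κ - 1), dist1 (GaugeField.plaqHol U q) with hSdef
  have hS0 : 0 ≤ S := Finset.sum_nonneg fun _ _ => GaugeGroup.dist1_nonneg _
  set K : ℝ := (((P.d + 2) * P.L : ℕ) : ℝ) ^ 2 / 4 with hKdef
  have hK0 : 0 ≤ K := by positivity
  refine le_of_forall_le_add_mul (x := dist1 (loopHol U c i)) (A := K * S) (B := K) hK0 fun η hη => ?_
  have hloc : ∀ q : Plaq P j, (blockOf q.src = c.src.unshift c.dir ∨ blockOf q.src = c.src ∨ blockOf q.src = c.tgt) →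
      dist1 (GaugeField.plaqHol U q) < S + η := by
    intro q hq
    refine lt_nbhd_sum_add U c.src hη q ?_
    rcases hq with hq | hq | hq <;> rw [hq]
    · exact near_unshift c.src c.dir
    · exact near_self c.src
    · exact near_shift c.src c.dir
  have h := dist1_loopHol_le_local (by linarith) hj c hloc i
  calc dist1 (loopHol U c i) ≤ K * (S + η) := h
    _ = K * S + K * η := by ring

/-! ## §3 The correction factor at one bond: `SU(N)`, under the global small-plaquette guard of `histGood` -/

variable {n : Type*} [Fintype n] [DecidableEq n] [Nonempty n]

/-- ★ **THE CORRECTION FACTOR IS BOUNDED BY THE NEIGHBOURHOOD FLUX SUM**: if every fine plaquette is within `δ` of `1` with `(((d+2)L)²∕4)·δ ≤ ¼` and `< δ_N`, then at every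
coarse bond `dist1 κ_c ≤ (3·((d+2)L)²∕4)·Σ_{q ∈ N(c₋)} dist1 U(∂q)` (✓G12 `dist1_corr_le_mean` — the guard through lit ✓`dist1_loopHol_le` — then §2 member by member and the
mean of a constant bound). [cite: Balaban1987RG1, (0.4) p.253; Balaban1985Averaging, (21) p.22, (26)-(27) p.22] -/
theorem dist1_corr_le_nbhd_sum (hj : j + 1 ≤ P.m + P.K) (U : GaugeField P j (Matrix.specialUnitaryGroup n ℂ)) (c : PBond P (j + 1)) {δ : ℝ} (hδ : 0 ≤ δ)
    (hU : PlaqSmall δ U) (hδ4 : ((((P.d + 2) * P.L : ℕ) : ℝ) ^ 2 / 4) * δ ≤ 1 / 4) (hδN : ((((P.d + 2) * P.L : ℕ) : ℝ) ^ 2 / 4) * δ < deltaSU n) :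
    dist1 (corr (expMeanLogSU (n := n)) U c) ≤ (3 * (((((P.d + 2) * P.L : ℕ) : ℝ) ^ 2 / 4))) *
      ∑ q ∈ Finset.univ.filter (fun q : Plaq P j => ∀ κ, blockOf q.src κ = c.src κ ∨ blockOf q.src κ = c.src κ + 1 ∨
        blockOf q.src κ = c.src κ - 1), dist1 (GaugeField.plaqHol U q) := by
  set K : ℝ := (((P.d + 2) * P.L : ℕ) : ℝ) ^ 2 / 4 with hKdef
  set S := ∑ q ∈ Finset.univ.filter (fun q : Plaq P j => ∀ κ, blockOf q.src κ = c.src κ ∨ blockOf q.src κ = c.src κ + 1 ∨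
        blockOf q.src κ = c.src κ - 1), dist1 (GaugeField.plaqHol U q) with hSdef
  -- G12 with the global guard `t := K·δ`
  have hθ : ∀ i, dist1 (loopHol U c i) ≤ K * δ := fun i => LatticeWordStokes.dist1_loopHol_le hδ hU c i
  have h12 := dist1_corr_le_mean U c hθ hδ4 hδN
  -- each member by §2
  have hmem : ∀ i, dist1 (loopHol U c i) ≤ K * S := fun i => dist1_loopHol_le_nbhd_sum hj U c i
  have hcard : (0 : ℝ) < (Fintype.card (Idx P) : ℝ) := by exact_mod_cast Fintype.card_pos
  have hmean : ((Fintype.card (Idx P) : ℝ))⁻¹ * ∑ i, dist1 (loopHol U c i) ≤ K * S := by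
    rw [inv_mul_le_iff₀ hcard]
    calc ∑ i, dist1 (loopHol U c i) ≤ ∑ _i : Idx P, K * S := Finset.sum_le_sum fun i _ => hmem i
      _ = (Fintype.card (Idx P) : ℝ) * (K * S) := by rw [Finset.sum_const, Finset.card_univ, nsmul_eq_mul]
  calc dist1 (corr (expMeanLogSU (n := n)) U c) ≤ 3 * (((Fintype.card (Idx P) : ℝ))⁻¹ * ∑ i, dist1 (loopHol U c i)) := h12
    _ ≤ 3 * (K * S) := by linarith
    _ = 3 * K * S := by ring

/-! ## §4 THE LETTER: the correction factor in `ℓ²` over all coarse bonds -/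

/-- ★★ **(F4) THE CORRECTION-FACTOR LETTER IN ℓ²**: under `PlaqSmall δ U` with `(((d+2)L)²∕4)·δ ≤ ¼` and `< δ_N`,
`√(Σ_{c : PBond} dist1 κ_c²) ≤ (3((d+2)L)²∕4)·√((3^d L^d d²)(3^d d))·√(Σ_q dist1 U(∂q)²)` — one level, constants polynomial in `L` (they land in (H)'s `C`, not in `√L`).
[cite: Balaban1987RG1, (0.4) p.253; Balaban1985Averaging, (19)-(21) pp.21-22] -/
theorem sqrt_sum_dist1_corr_sq_le (hj : j + 1 ≤ P.m + P.K) (U : GaugeField P j (Matrix.specialUnitaryGroup n ℂ)) {δ : ℝ} (hδ : 0 ≤ δ)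
    (hU : PlaqSmall δ U) (hδ4 : ((((P.d + 2) * P.L : ℕ) : ℝ) ^ 2 / 4) * δ ≤ 1 / 4) (hδN : ((((P.d + 2) * P.L : ℕ) : ℝ) ^ 2 / 4) * δ < deltaSU n) :
    √(∑ c : PBond P (j + 1), dist1 (corr (expMeanLogSU (n := n)) U c) ^ 2) ≤
      (3 * (((((P.d + 2) * P.L : ℕ) : ℝ) ^ 2 / 4))) * √(((3 ^ P.d * P.L ^ P.d * P.d ^ 2 : ℕ) : ℝ) * ((3 ^ P.d * P.d : ℕ) : ℝ)) *
        √(∑ q : Plaq P j, dist1 (GaugeField.plaqHol U q) ^ 2) :=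
  sqrt_sum_sq_le_of_le_bond_nbhd_sum hj (fun q => dist1 (GaugeField.plaqHol U q)) (fun c => dist1 (corr (expMeanLogSU (n := n)) U c))
    (by positivity) (fun _ => GaugeGroup.dist1_nonneg _) (fun c => dist1_corr_le_nbhd_sum hj U c hδ hU hδ4 hδN)

/-! ## §5 The SPINE edition — the `hF4` binder of ✓p817191 `relLetter_of_feeders` -/

/-- ★★★ **(F4) IN SPINE CURRENCY**: if the coarse field `U₀` has the straight rows of the (0.4) average of `W` (`T_c(U₀) = ū_c(W)` for every coarse bond — for the hFlat tower:
`U₀ := lift_t U′_{t+1}`, by (T5) and ✓`axialAvg_lift`), then under the same guard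
`√(Σ_c dist1 (T_c(W)·T_c(U₀)⁻¹)²) ≤ (3((d+2)L)²∕4)·√((3^d L^d d²)(3^d d))·√(Σ_q dist1 W(∂q)²)` (`T_c(W)·T_c(U₀)⁻¹ = κ_c(W)⁻¹`, ✓(b3) `axialAvg_mul_avgFun_inv`, `dist1_inv`).
[cite: Balaban1987RG1, (0.4) p.253; Balaban1985Averaging, (19)-(21) pp.21-22] -/
theorem sqrt_sum_dist1_spine_sq_le (hj : j + 1 ≤ P.m + P.K) (W U₀ : GaugeField P j (Matrix.specialUnitaryGroup n ℂ))
    (havg : ∀ c : PBond P (j + 1), AveragingRT.axialAvg U₀ c = avgFun (expMeanLogSU (n := n)) W c) {δ : ℝ} (hδ : 0 ≤ δ)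
    (hW : PlaqSmall δ W) (hδ4 : ((((P.d + 2) * P.L : ℕ) : ℝ) ^ 2 / 4) * δ ≤ 1 / 4) (hδN : ((((P.d + 2) * P.L : ℕ) : ℝ) ^ 2 / 4) * δ < deltaSU n) :
    √(∑ c : PBond P (j + 1), dist1 (AveragingRT.axialAvg W c * (AveragingRT.axialAvg U₀ c)⁻¹) ^ 2) ≤
      (3 * (((((P.d + 2) * P.L : ℕ) : ℝ) ^ 2 / 4))) * √(((3 ^ P.d * P.L ^ P.d * P.d ^ 2 : ℕ) : ℝ) * ((3 ^ P.d * P.d : ℕ) : ℝ)) *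
        √(∑ q : Plaq P j, dist1 (GaugeField.plaqHol W q) ^ 2) := by
  have e : ∀ c : PBond P (j + 1), dist1 (AveragingRT.axialAvg W c * (AveragingRT.axialAvg U₀ c)⁻¹) = dist1 (corr (expMeanLogSU (n := n)) W c) := by
    intro c
    rw [havg c, axialAvg_mul_avgFun_inv, GaugeGroup.dist1_inv]
  simp only [e]
  exact sqrt_sum_dist1_corr_sq_le hj W hδ hW hδ4 hδN

end Summit.QuantumFields.YangMills.Theorems.FluctuationComparisonRegPrIntLS2BetaCorrLetterL2

end
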